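import Summits.QuantumFields.YangMills.Theorems.BalabanUVNodesPortHDecayOfRowsTrace

/-!
# PORT PT-H (slot 8, JOIN side; ORDER O-3 ∕ Q-11 (W2a), Q-11b-ready) — THE COLOUR-INDEXED TEXT T-3″ PROVED: «(1.19)-mould, chart on the (4.4) domain, Ward rows, gauge-currency
# response rows, leaves and response link FOR EVERY COLOUR, (1.21) ⟹ (5.10) decay of the limit kernel» — no colour-scalar row, no colour choice (CRIT-1's typing condition (C))

Cell `ym-nodeO-ideate` ∕ `ym-balaban-port`, porter seat `ymgap-nodeO-port-PTC-1` (gen 2; slot-8 closer; ORDER O-3, keyed `--supports stmt-QuantumFields-27238 --as helper`).  The type of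
★★ `portPiDecayUniformH_colourIndexed` is the NODE-O cover's CANDIDATE text T-3″ VERBATIM (lens-1 g4 `nodeO-cover/LENS-1-SigT3pp-candidate-v1.txt` sha16 `e6528f80865f75f1`, 3 551 ch =
the signed T-3′ 9e27aaca with RowS′ DELETED, `aStar` REMOVED, `R : ι → Response9Data …`, the rows `FormatPlusG ∕ cut-locality ∕ Response9D ∕ RowG ∕ RowL` holding for every colour,
conclusion and constant shape unchanged — exactly CRIT-1's typing condition (C), nodeO STATUS 2026-08-31T01:03:08Z; lens-1's `LENS-1-Slot8RecordJoin-v3.lean` carries it as the HYPOTHESIS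
`SlotT3pp` of `recordDecay_of_slotT3pp ∕ joinGoal_of_texts₂`).  With this file that hypothesis is a THEOREM: the record JOIN (lens-1's §10, re-keyed to the dressed chart `recordEmbL` ∕
`recordResponse9DataFromL` per CRIT-1 Q-12 (J)) no longer carries any slot-text premise and no (A4) row.  NOT a slot of record (Q-11b is the director's calendar item); if T-3″ is ever cut
and signed with these bytes, this theorem closes it verbatim.
* `polComp_diag_eq_sum_re_mixedDeriv₁` ∕ `abs_polComp_diag_le_of_rows₁` — the per-colour (4.37) identity and (5.10) core of `…PortHDecayOfRowsTrace` with the response link AT ONE COLOUR only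
  (the colour-`a` data `R a` carry their own label type).
* ★★ `portPiDecayUniformH_colourIndexed` — per colour `a`: the pieces of `FormatPlusG … (R a).wrap (R a).emb (R a).πc`, (4.14) by `ward414_of_gaugeInv119_chart44D`, the core at `R a`;
  the window identification eventually for ALL colours at once (`Filter.eventually_all`, finite `ι`); the average through `pvolOf_eq_trace`; `B12Decay510.decay510_of_tendsto` along (1.21).
  Witness `C := 16·E₀·C₉²·exp(δ₁·Mg·c₁)·K₀·max K₁ 0`.
HONEST FRAMING.  A FREE generic implication over displayed rows (all hypotheses — the OPEN port texts' consequents per colour); proves nothing of Bałaban; T-3″ is a CANDIDATE text, unsigned;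
the record JOIN it serves routes hypotheses into K0ᴬ's stub; finite `𝕋⁴_{L^K}` at fixed ε — NOT continuum ∕ OS ∕ Clay; **the Yang–Mills mass gap is NOT proved.**  No `def`, `instance`, `sorry`.
-/

noncomputable section

open Filter Topology
open scoped BigOperators

namespace Summit.QuantumFields.YangMills.Theorems.PortH

open Literature.MathematicalPhysics.QuantumFieldTheory.Balaban1983to89
open Literature.MathematicalPhysics.QuantumFieldTheory.Balaban1983to89.Node00 (TermFamily1 siteOfInt polWindow polScalar)
open Literature.MathematicalPhysics.QuantumFieldTheory.Balaban1983to89.T4Continuum (T4Family)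
open Literature.MathematicalPhysics.QuantumFieldTheory.Balaban1983to89.B12FormatPlus
open Literature.MathematicalPhysics.QuantumFieldTheory.Balaban1983to89.B12Decay510 (GeomLeaf CubeSumLeaf TreeLeaf delta1 mixedDeriv decay510_of_tendsto)
open Literature.MathematicalPhysics.QuantumFieldTheory.Balaban1983to89.B12Decay510Gauge (abs_twoPoint_le_of_gauge)
open Literature.MathematicalPhysics.QuantumFieldTheory.Balaban1983to89.B12Eq435SecondVariation (ofReal_fderiv_fderiv_eq_sum_mixedDeriv_of_repr)
open Literature.MathematicalPhysics.QuantumFieldTheory.Balaban1983to89.Beta.RemainderLocality (mixedDeriv_comp_clm)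
open Summit.QuantumFields.YangMills.Theorems.K0RecordFormatNames (ΦfOf pvolOf plimOf)
open Summit.QuantumFields.YangMills.Theorems.BalabanUVNodesPortS1 (ward414_of_gaugeInv119_chart44D)

section PerColour

variable (F : T4Family) {𝔄 : Type} [NormedRing 𝔄] [NormedAlgebra ℝ 𝔄] {V : Type} [NormedAddCommGroup V] [NormedSpace ℝ V] {ι : Type} [Fintype ι]
  (fam : TermFamily1 F 𝔄) (ρ : V →L[ℝ] 𝔄) (bV : Module.Basis ι ℝ V) (k : ℕ) (v : Fin (k + 1) → ℝ)
  {S : ℕ → LocDomainSys} {M m : ℕ → ℕ}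

omit [Fintype ι] in
/-- ★ **(4.37) PER VOLUME AND PER COLOUR**: under the (1.19)-mould's pieces for `ΦfOf F fam ρ k v (K n)`, the chart on a (4.4)-domain, (4.14), the (A3)∕(1.7) cut and a COLOUR-INDEXED
response link, the diagonal component `Π^{aa}_{01}(z, 0)` of (1.20) IS `Σ_X Re ∂²(𝐄ₙ(X)∘χ_X)[cutTo cX (Gc n a (e 1 0)), cutTo cX (Gc n a (e 0 z))]`.
[cite: Balaban1987RG1, (4.35) p.290, (4.37) p.291, (1.20) p.264, (1.7) p.261] -/
theorem polComp_diag_eq_sum_re_mixedDeriv₁ (Uc : (n : ℕ) → (S n).Dom → Set (Fin (M n) → ℂ)) (coords : (n : ℕ) → (S n).Dom → Finset (Fin (M n)))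
    (χ : (n : ℕ) → (S n).Dom → (Fin (m n) → ℂ) → (Fin (M n) → ℂ)) (D : (n : ℕ) → (S n).Dom → Set (Fin (m n) → ℂ))
    (E : Pieces S M) (R : Response9Data S M m 4) (K : ℕ → ℕ) (Gc : (n : ℕ) → ι → R.Λ n → (Fin (m n) → ℂ))
    (ιe : (n : ℕ) → (Fin (F.P (K n)).d → Site (F.P (K n)) (k + 1) → V) → (Fin (m n) → ℂ))
    (hAn : Analytic19 Uc E) (hLoc : Local17 coords E) (hRep : Repr17 S E χ (fun n => ΦfOf F fam ρ k v (K n)) ιe) (hW : Ward414 χ E)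
    (hC : Chart44D S M Uc m χ D) (hcut : ∀ n X u, ∀ i ∈ coords n X, χ n X (cutTo (R.cX n X) u) i = χ n X u i)
    (n : ℕ) (a : ι)
    (hL : ιe n 0 = 0 ∧ ContDiffAt ℝ 2 (ιe n) 0 ∧ ∀ (μ : Fin 4) (z : Fin 4 → ℤ),
      Gc n a (R.e n μ z) = fderiv ℝ (ιe n) 0 (Pi.single (Fin.cast (F.P_d (K n)).symm μ) (Pi.single (siteOfInt F (K n) (k + 1) z) (bV a))))
    (z : Fin 4 → ℤ) :
    B12PolarizationTensor120.polComp ℝ (B12PolarizationTensor120.expChart (fam k v (K n)) ρ) bV (Fin.cast (F.P_d (K n)).symm 0) (siteOfInt F (K n) (k + 1) z) a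
        (Fin.cast (F.P_d (K n)).symm 1) (siteOfInt F (K n) (k + 1) 0) a =
      ∑ X, (mixedDeriv (fun u => E n X (χ n X u)) (cutTo (R.cX n X) (Gc n a (R.e n 1 0))) (cutTo (R.cX n X) (Gc n a (R.e n 0 z)))).re := by
  classical
  obtain ⟨hι0, hιC2, hGk⟩ := hL
  have hF : ∀ X, AnalyticAt ℂ (fun u => E n X (χ n X u)) 0 := fun X => by
    obtain ⟨-, -, -, h0, hχan, hmaps⟩ := hC n X
    exact (hAn n X (χ n X 0) (hmaps h0)).comp (hχan 0 h0)
  have hrepr : (fun B => ((B12PolarizationTensor120.expChart (fam k v (K n)) ρ B : ℝ) : ℂ)) =ᶠ[𝓝 0]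
      fun B => ∑ X, (fun u => E n X (χ n X u)) (ιe n B) := hRep n
  set p : Fin (F.P (K n)).d → Site (F.P (K n)) (k + 1) → V := Pi.single (Fin.cast (F.P_d (K n)).symm 0) (Pi.single (siteOfInt F (K n) (k + 1) z) (bV a)) with hp
  set q : Fin (F.P (K n)).d → Site (F.P (K n)) (k + 1) → V := Pi.single (Fin.cast (F.P_d (K n)).symm 1) (Pi.single (siteOfInt F (K n) (k + 1) 0) (bV a)) with hq
  have hbridge := (ofReal_fderiv_fderiv_eq_sum_mixedDeriv_of_repr (fun X u => E n X (χ n X u)) (ιe n) _ hrepr hι0 hιC2 hF (hW n) p q).2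
  -- `polComp` is that second derivative (definition of `polComp ∕ polTensor`)
  have hpc : ((B12PolarizationTensor120.polComp ℝ (B12PolarizationTensor120.expChart (fam k v (K n)) ρ) bV (Fin.cast (F.P_d (K n)).symm 0)
      (siteOfInt F (K n) (k + 1) z) a (Fin.cast (F.P_d (K n)).symm 1) (siteOfInt F (K n) (k + 1) 0) a : ℝ) : ℂ) =
      ∑ X, mixedDeriv (fun u => E n X (χ n X u)) (fderiv ℝ (ιe n) 0 q) (fderiv ℝ (ιe n) 0 p) := hbridge
  rw [← hGk 1 0, ← hGk 0 z] at hpc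
  have hcutEq : ∀ X (a' b' : Fin (m n) → ℂ), mixedDeriv (fun u => E n X (χ n X u)) a' b' =
      mixedDeriv (fun u => E n X (χ n X u)) (cutTo (R.cX n X) a') (cutTo (R.cX n X) b') := by
    intro X a' b'
    obtain ⟨T, hT⟩ := exists_cutTo_clm (R.cX n X)
    have hfun : (fun u => E n X (χ n X u)) = fun u => (fun u => E n X (χ n X u)) (T u) := by
      funext u; rw [hT]; exact (hLoc n X _ _ fun i hi => (hcut n X u i hi)).symm
    obtain ⟨r, hr, hball⟩ : ∃ r > 0, ∀ y ∈ Metric.ball (0 : Fin (m n) → ℂ) r, DifferentiableAt ℂ (fun u => E n X (χ n X u)) y := by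
      obtain ⟨s, hs, hsub⟩ := Metric.mem_nhds_iff.1 (hF X).eventually_analyticAt
      exact ⟨s, hs, fun y hy => (hsub hy).differentiableAt⟩
    conv_lhs => rw [hfun]
    rw [mixedDeriv_comp_clm hr hball T a' b', hT, hT]
  rw [Finset.sum_congr rfl fun X _ => hcutEq X _ _] at hpc
  have := congrArg Complex.re hpc
  rw [Complex.ofReal_re, Complex.re_sum] at this
  exact this
omit [Fintype ι] in
/-- ★ **THE PER-COLOUR CORE at one volume** (CRIT-1 Q-11 (W2a): «the Cauchy∕(5.10) bound for the (a,a) component from the rows AT COLOUR a»): for pieces `E` with (1.9) analyticity,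
(1.18), (1.7) locality, the representation of `ΦfOf F fam ρ k v (K n)` and (4.14), the chart on a (4.4)-domain with the (A3) cut, the gauge decay of the cut responses OF COLOUR `a`, the three
leaves at volume `n` and the colour-`a` response link: `|Π^{aa}_{01}(z, 0)| ≤ 16·E₀·C₉²·e^{δ₁Mg c₁}·K₀·K₁·e^{−δ₁ρₙ(e 1 0, e 0 z)}`, `δ₁ = ½ min{δ₀, κ∕Mg}`.
[cite: Balaban1987RG1, (5.10) p.293, (4.35)–(4.37) pp.290–291, (4.4)–(4.5) pp.281–282; Balaban1985Variational, Prop. 9 p.309] -/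
theorem abs_polComp_diag_le_of_rows₁ (Uc : (n : ℕ) → (S n).Dom → Set (Fin (M n) → ℂ)) (coords : (n : ℕ) → (S n).Dom → Finset (Fin (M n)))
    (χ : (n : ℕ) → (S n).Dom → (Fin (m n) → ℂ) → (Fin (M n) → ℂ)) (D : (n : ℕ) → (S n).Dom → Set (Fin (m n) → ℂ))
    (E : Pieces S M) (R : Response9Data S M m 4) (K : ℕ → ℕ) (Gc : (n : ℕ) → ι → R.Λ n → (Fin (m n) → ℂ))
    (ιe : (n : ℕ) → (Fin (F.P (K n)).d → Site (F.P (K n)) (k + 1) → V) → (Fin (m n) → ℂ))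
    {E₀ κ C₉ δ₀ Mg c₁ K₀ K₁ : ℝ} (hE₀ : 0 ≤ E₀) (hκ : 0 ≤ κ) (hC₉ : 0 ≤ C₉) (hδ₀ : 0 ≤ δ₀) (hMg : 0 < Mg) (hK₀ : 0 ≤ K₀)
    (hAn : Analytic19 Uc E) (hB : Bound118 S Uc E E₀ κ) (hLoc : Local17 coords E) (hRep : Repr17 S E χ (fun n => ΦfOf F fam ρ k v (K n)) ιe)
    (hW : Ward414 χ E) (hC : Chart44D S M Uc m χ D) (hcut : ∀ n X u, ∀ i ∈ coords n X, χ n X (cutTo (R.cX n X) u) i = χ n X u i)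
    (n : ℕ) (a : ι)
    (hdec : ∀ X y, gauge (D n X) (cutTo (R.cX n X) (Gc n a y)) ≤ C₉ * Real.exp (-δ₀ * (R.G n).distD y X))
    (hgeo : GeomLeaf (R.G n) (R.ρ n) Mg c₁) (hcube : CubeSumLeaf (R.G n) (δ₀ / 2) K₁) (htree : TreeLeaf (R.Cc n) (κ / 2) K₀)
    (hL : ιe n 0 = 0 ∧ ContDiffAt ℝ 2 (ιe n) 0 ∧ ∀ (μ : Fin 4) (z : Fin 4 → ℤ),
      Gc n a (R.e n μ z) = fderiv ℝ (ιe n) 0 (Pi.single (Fin.cast (F.P_d (K n)).symm μ) (Pi.single (siteOfInt F (K n) (k + 1) z) (bV a))))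
    (z : Fin 4 → ℤ) :
    |B12PolarizationTensor120.polComp ℝ (B12PolarizationTensor120.expChart (fam k v (K n)) ρ) bV (Fin.cast (F.P_d (K n)).symm 0)
        (siteOfInt F (K n) (k + 1) z) a (Fin.cast (F.P_d (K n)).symm 1) (siteOfInt F (K n) (k + 1) 0) a| ≤
      16 * E₀ * C₉ ^ 2 * Real.exp (delta1 δ₀ κ Mg * Mg * c₁) * K₀ * K₁ * Real.exp (-(delta1 δ₀ κ Mg) * R.ρ n (R.e n 1 0) (R.e n 0 z)) := by
  rw [polComp_diag_eq_sum_re_mixedDeriv₁ F fam ρ bV k v Uc coords χ D E R K Gc ιe hAn hLoc hRep hW hC hcut n a hL z]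
  have hD : ∀ X : (S n).Dom, Convex ℝ (D n X) ∧ Balanced ℂ (D n X) ∧ IsOpen (D n X) ∧ (0 : Fin (m n) → ℂ) ∈ D n X := fun X => by
    obtain ⟨h1, h2, h3, h4, -, -⟩ := hC n X; exact ⟨h1, h2, h3, h4⟩
  have han : ∀ X : (S n).Dom, AnalyticOnNhd ℂ (fun u => E n X (χ n X u)) (D n X) := fun X w hw => by
    obtain ⟨-, -, -, -, hχan, hmaps⟩ := hC n X
    exact (hAn n X (χ n X w) (hmaps hw)).comp (hχan w hw)
  have h118 : ∀ X : (S n).Dom, ∀ w ∈ D n X, ‖E n X (χ n X w)‖ ≤ E₀ * Real.exp (-κ * (S n).dj X) := fun X w hw => by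
    obtain ⟨-, -, -, -, -, hmaps⟩ := hC n X
    exact (bound118_iff Uc E E₀ κ).1 hB n X _ (hmaps hw)
  exact abs_twoPoint_le_of_gauge (R.G n) (ρ := R.ρ n) (fun X u => E n X (χ n X u)) (D n) (fun X y => cutTo (R.cX n X) (Gc n a y))
    (fun X x y => (mixedDeriv (fun u => E n X (χ n X u)) (cutTo (R.cX n X) (Gc n a x)) (cutTo (R.cX n X) (Gc n a y))).re)
    hE₀ hC₉ hK₀ hδ₀ hκ hMg hD han h118 (fun _ _ _ => rfl) (fun X y => hdec X y) hgeo hcube htree _ _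
end PerColour

/-- ★★ **THE COLOUR-INDEXED SLOT TEXT T-3″ (candidate bytes `LENS-1-SigT3pp-candidate-v1.txt` e6528f80865f75f1), PROVED** — rows for every colour ⟹ (5.10) decay of the (1.21) limit
kernel's `(0,1)`-component with ONE constant (`C = 16E₀C₉²e^{δ₁Mg c₁}K₀·max K₁ 0`); the normalised colour trace is averaged, no colour-scalar∕(A4) row is read.
[cite: Balaban1987RG1, (5.10) p.293, (4.35)–(4.37) pp.290–291, (1.18)–(1.21) pp.263–264, (4.4)–(4.5) pp.281–282, (4.14) p.284; Balaban1985Variational, Prop. 9 p.309] -/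
theorem portPiDecayUniformH_colourIndexed :
    ∀ (E₀ κ C₉ δ₀ Mg c₁ K₀ K₁ : ℝ), 0 ≤ E₀ → 0 < κ → 0 < δ₀ → 0 < Mg → 0 ≤ K₀ → ∃ C : ℝ, 0 ≤ C ∧ ∀ (F : Literature.MathematicalPhysics.QuantumFieldTheory.Balaban1983to89.T4Continuum.T4Family) (𝔄 : Type) [NormedRing 𝔄] [NormedAlgebra ℝ 𝔄] (V : Type) [NormedAddCommGroup V] [NormedSpace ℝ V] (ι : Type) [Fintype ι] [DecidableEq ι] (fam : Literature.MathematicalPhysics.QuantumFieldTheory.Balaban1983to89.Node00.TermFamily1 F 𝔄) (ρ : V →L[ℝ] 𝔄) (bV : Module.Basis ι ℝ V) (k : ℕ) (v : Fin (k + 1) → ℝ) (S : ℕ → Literature.MathematicalPhysics.QuantumFieldTheory.Balaban1983to89.LocDomainSys) (M m : ℕ → ℕ) (Uc : (n : ℕ) → (S n).Dom → Set (Fin (M n) → ℂ)) (coords : (n : ℕ) → (S n).Dom → Finset (Fin (M n))) (χ : (n : ℕ) → (S n).Dom → (Fin (m n) → ℂ) → (Fin (M n) → ℂ)) (D : (n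 : ℕ) → (S n).Dom → Set (Fin (m n) → ℂ)) (Gg : ℕ → Type) (act : (n : ℕ) → Gg n → (Fin (M n) → ℂ) → (Fin (M n) → ℂ)) (Hg : ℕ → Type) (toG : (n : ℕ) → Hg n → Gg n) (A : (n : ℕ) → Hg n → ((Fin (m n) → ℂ) →L[ℂ] (Fin (m n) → ℂ))) (R : ι → Literature.MathematicalPhysics.QuantumFieldTheory.Balaban1983to89.B12FormatPlus.Response9Data S M m 4) (Nw : ℕ → ℕ) (K : ℕ → ℕ) (ιe : (n : ℕ) → (Fin (F.P (K n)).d → Literature.MathematicalPhysics.QuantumFieldTheory.Balaban1983to89.Site (F.P (K n)) (k + 1) → V) → (Fin (m n) → ℂ)), (∀ a : ι, Literature.MathematicalPhysics.QuantumFieldTheory.Balaban1983to89.B12FormatPlus.FormatPlusG S M act Uc coords m χ (fun n => Summit.QuantumFields.YangMills.Theorems.K0RecordFormatNames.ΦfOf F fam ρ k v (K n)) ιe (R a).wrap (R a).emb (R a).πc E₀ κ) → Literature.MathematicalPhysics.QuantumFieldTheory.Balaban1983to89.B12FormatPlus.Chart44D S M Uc m χ D → (Literature.MathematicalPhysics.QuantumFieldTheory.Balaban1983to89.B12FormatPlus.ChartEquivariant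 toG act χ A ∧ (∀ n, Literature.MathematicalPhysics.QuantumFieldTheory.Balaban1983to89.B12FormatPlus.NoInvariantCovector (A n)) ∧ ∀ (a : ι) n X u, ∀ i ∈ coords n X, χ n X (Literature.MathematicalPhysics.QuantumFieldTheory.Balaban1983to89.B12FormatPlus.cutTo ((R a).cX n X) u) i = χ n X u i) → (∀ a : ι, Literature.MathematicalPhysics.QuantumFieldTheory.Balaban1983to89.B12FormatPlus.Response9D (R a) χ Nw D C₉ δ₀) → (∀ a : ι, (∀ n, Literature.MathematicalPhysics.QuantumFieldTheory.Balaban1983to89.B12Decay510.GeomLeaf ((R a).G n) ((R a).ρ n) Mg c₁ ∧ Literature.MathematicalPhysics.QuantumFieldTheory.Balaban1983to89.B12Decay510.CubeSumLeaf ((R a).G n) (δ₀ / 2) K₁ ∧ Literature.MathematicalPhysics.QuantumFieldTheory.Balaban1983to89.B12Decay510.TreeLeaf ((R a).Cc n) (κ / 2) K₀) ∧ ∀ (μ ν : Fin 4) (z : Fin 4 → ℤ), ∀ᶠ n in Filter.atTop, (R a).ρ n ((R a).e n μ 0) ((R a).e n ν z) = Literature.MathematicalPhysics.QuantumFieldTheory.Balaban1983to89.B12Sec2to5.l1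 z) → (∀ n, ιe n 0 = 0 ∧ ContDiffAt ℝ 2 (ιe n) 0 ∧ ∀ (a : ι) (μ : Fin 4) (z : Fin 4 → ℤ), (R a).Gk n ((R a).e n μ z) = fderiv ℝ (ιe n) 0 (Pi.single (Fin.cast (F.P_d (K n)).symm μ) (Pi.single (Literature.MathematicalPhysics.QuantumFieldTheory.Balaban1983to89.Node00.siteOfInt F (K n) (k + 1) z) (bV a)))) → Literature.MathematicalPhysics.QuantumFieldTheory.Balaban1983to89.B12FormatPlus.Limit121 (fun n => Summit.QuantumFields.YangMills.Theorems.K0RecordFormatNames.pvolOf F fam ρ bV k v (K n)) (Summit.QuantumFields.YangMills.Theorems.K0RecordFormatNames.plimOf F fam ρ bV k v) → Literature.MathematicalPhysics.QuantumFieldTheory.Balaban1983to89.B12Sec2to5.Decay510 (Summit.QuantumFields.YangMills.Theorems.K0RecordFormatNames.plimOf F fam ρ bV k v 0 1) C (Literature.MathematicalPhysics.QuantumFieldTheory.Balaban1983to89.B12Decay510.delta1 δ₀ κ Mg) := by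
  classical
  intro E₀ κ C₉ δ₀ Mg c₁ K₀ K₁ hE₀ hκ hδ₀ hMg hK₀
  have hCK : 0 ≤ 16 * E₀ * C₉ ^ 2 * Real.exp (delta1 δ₀ κ Mg * Mg * c₁) * K₀ :=
    mul_nonneg (mul_nonneg (mul_nonneg (mul_nonneg (by norm_num) hE₀) (sq_nonneg _)) (Real.exp_pos _).le) hK₀
  refine ⟨16 * E₀ * C₉ ^ 2 * Real.exp (delta1 δ₀ κ Mg * Mg * c₁) * K₀ * max K₁ 0, mul_nonneg hCK (le_max_right _ _), ?_⟩
  intro F 𝔄 _ _ V _ _ ι _ _ fam ρ bV k v S M m Uc coords χ D Gg act Hg toG A R Nw K ιe hA hC hRowC hR hRowG hL hLim z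
  refine decay510_of_tendsto (fun n z => pvolOf F fam ρ bV k v (K n) 0 1 z) (fun z => hLim 0 1 z) (fun z => ?_) z
  -- the window identification, eventually for all colours at once
  have hev : ∀ᶠ n in atTop, ∀ a : ι, (R a).ρ n ((R a).e n 1 0) ((R a).e n 0 z) = B12Sec2to5.l1 z :=
    Filter.eventually_all.2 fun a => (hRowG a).2 1 0 z
  filter_upwards [hev] with n hn
  set Cz : ℝ := 16 * E₀ * C₉ ^ 2 * Real.exp (delta1 δ₀ κ Mg * Mg * c₁) * K₀ * max K₁ 0 * Real.exp (-(delta1 δ₀ κ Mg) * B12Sec2to5.l1 z) with hCz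
  have hCz0 : 0 ≤ Cz := mul_nonneg (mul_nonneg hCK (le_max_right _ _)) (Real.exp_pos _).le
  -- per colour, the (5.10) bound at this volume
  have hcol : ∀ a : ι, |B12PolarizationTensor120.polComp ℝ (B12PolarizationTensor120.expChart (fam k v (K n)) ρ) bV (Fin.cast (F.P_d (K n)).symm 0)
      (siteOfInt F (K n) (k + 1) z) a (Fin.cast (F.P_d (K n)).symm 1) (siteOfInt F (K n) (k + 1) 0) a| ≤ Cz := by
    intro a
    obtain ⟨E, hAn, hB, hLoc, hRep, -, hG⟩ := hA a
    have hW : Ward414 χ E := ward414_of_gaugeInv119_chart44D hG hRowC.1 hC hAn hRowC.2.1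
    have hC₉ : 0 ≤ C₉ := (hR a).consts_nonneg.1
    have h1 := abs_polComp_diag_le_of_rows₁ F fam ρ bV k v Uc coords χ D E (R a) K (fun n _ y => (R a).Gk n y) ιe hE₀ hκ.le hC₉ hδ₀.le hMg hK₀
      hAn hB hLoc hRep hW hC (hRowC.2.2 a) n a (fun X y => (hR a).decay n X y) ((hRowG a).1 n).1 ((hRowG a).1 n).2.1 ((hRowG a).1 n).2.2
      ⟨(hL n).1, (hL n).2.1, fun μ z' => (hL n).2.2 a μ z'⟩ z
    rw [hn a] at h1
    refine h1.trans (mul_le_mul_of_nonneg_right (mul_le_mul_of_nonneg_left (le_max_left _ _) hCK) (Real.exp_pos _).le)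
  -- average over the colours (pvolOf IS the normalised trace)
  rw [pvolOf_eq_trace]
  have hsum : |∑ a : ι, B12PolarizationTensor120.polComp ℝ (B12PolarizationTensor120.expChart (fam k v (K n)) ρ) bV (Fin.cast (F.P_d (K n)).symm 0)
      (siteOfInt F (K n) (k + 1) z) a (Fin.cast (F.P_d (K n)).symm 1) (siteOfInt F (K n) (k + 1) 0) a| ≤ (Fintype.card ι : ℝ) * Cz :=
    (Finset.abs_sum_le_sum_abs _ _).trans <| by
      calc ∑ a : ι, |B12PolarizationTensor120.polComp ℝ (B12PolarizationTensor120.expChart (fam k v (K n)) ρ) bV (Fin.cast (F.P_d (K n)).symm 0)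
              (siteOfInt F (K n) (k + 1) z) a (Fin.cast (F.P_d (K n)).symm 1) (siteOfInt F (K n) (k + 1) 0) a|
          ≤ ∑ _a : ι, Cz := Finset.sum_le_sum fun a _ => hcol a
        _ = (Fintype.card ι : ℝ) * Cz := by rw [Finset.sum_const, Finset.card_univ, nsmul_eq_mul]
  rw [abs_mul, abs_inv, Nat.abs_cast]
  rcases Nat.eq_zero_or_pos (Fintype.card ι) with h0 | hpos
  · rw [h0, Nat.cast_zero, inv_zero, zero_mul]; exact hCz0
  · have hcard : (0 : ℝ) < Fintype.card ι := Nat.cast_pos.2 hpos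
    calc (Fintype.card ι : ℝ)⁻¹ * |∑ a : ι, _| ≤ (Fintype.card ι : ℝ)⁻¹ * ((Fintype.card ι : ℝ) * Cz) :=
          mul_le_mul_of_nonneg_left hsum (inv_nonneg.2 hcard.le)
      _ = Cz := by field_simp

end Summit.QuantumFields.YangMills.Theorems.PortH

end
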